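import Mathlib.Geometry.Euclidean.Angle.Unoriented.Basic
import Mathlib.Analysis.InnerProductSpace.PiL2
import Mathlib.Analysis.SpecialFunctions.Trigonometric.Bounds
import HarnessLib

/-!
# From `cos d(y, z) ≈ ⟨Φ(y), Φ(z)⟩` to a Gromov–Hausdorff approximation into the round sphere

Elementary Euclidean lemmas for the last step of Colding's volume sphere theorem
(`Colding1996_volume_ghClose`): once the cosine coordinates `Φ = (cos d(x_i, ·))_i : M → ℝⁿ⁺¹` of
an almost orthogonal frame satisfy `|‖Φ‖² − 1| ≤ ψ` and `|⟨Φ(y), Φ(z)⟩ − cos d(y, z)| ≤ Ψ`, the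
normalised map `Φ/‖Φ‖ : M → Sⁿ` distorts `d` against the spherical distance `∠` by
`≤ π √(2Ψ + 2ψ)` (`abs_cos_angle_sub_le`, `abs_sub_le_pi_mul_sqrt_of_abs_cos_sub_cos_le`), and a
point `q` with `‖Φ(q) − c̃‖ ≤ t` for a unit vector `c̃` has `∠(Φ(q), c̃) ≤ π t`
(`angle_le_pi_mul_of_norm_sub_le`).

* `abs_sub_le_pi_mul_sqrt_of_abs_cos_sub_cos_le` — `a, b ∈ [0, π]`, `|cos a − cos b| ≤ t ⇒ |a − b| ≤ π√(t/2)`;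
* `abs_cos_angle_sub_le` — `|cos ∠(u, v) − C| ≤ 2Ψ + 2ψ`;
* `angle_le_pi_mul_of_norm_sub_le` — `‖w‖ = 1`, `‖u − w‖ ≤ t ⇒ ∠(u, w) ≤ π t`;
* `inner_toLp_toLp`, `norm_toLp_sq` — coordinates in `EuclideanSpace ℝ ι`.

Everything here is proved; no definitions, no named facts (D-0026).

## References

* T. H. Colding, *Shape of manifolds with positive Ricci curvature*, Invent. Math. 124 (1996)
  175–191, §2. [Colding1996Shape]
-/

noncomputable section

open Set InnerProductGeometry
open scoped BigOperators RealInnerProductSpace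

namespace Literature.Geometry.Riemannian

namespace ColdingSynthetic

/-! ### Comparing angles through their cosines -/

/-- `a, b ∈ [0, π]`, `|cos a − cos b| ≤ t ⇒ |a − b| ≤ π √(t/2)`:
`cos a − cos b = −2 sin((a+b)/2) sin((a−b)/2)` with `sin((a+b)/2) ≥ sin(|a−b|/2) ≥ |a−b|/π`.
[folklore] -/
theorem abs_sub_le_pi_mul_sqrt_of_abs_cos_sub_cos_le {a b t : ℝ} (ha0 : 0 ≤ a) (haπ : a ≤ Real.pi)
    (hb0 : 0 ≤ b) (hbπ : b ≤ Real.pi) (h : |Real.cos a - Real.cos b| ≤ t) :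
    |a - b| ≤ Real.pi * Real.sqrt (t / 2) := by
  -- reduce to `b ≤ a`
  wlog hab : b ≤ a generalizing a b
  · have h' : |Real.cos b - Real.cos a| ≤ t := by rwa [abs_sub_comm]
    have := this hb0 hbπ ha0 haπ h' (le_of_not_ge hab)
    rwa [abs_sub_comm]
  have hd0 : 0 ≤ a - b := by linarith
  rw [abs_of_nonneg hd0]
  set u : ℝ := (a - b) / 2 with hu
  set v : ℝ := (a + b) / 2 with hv
  have hu0 : 0 ≤ u := by positivity
  have huπ : u ≤ Real.pi / 2 := by rw [hu]; linarith
  have hcos : Real.cos a - Real.cos b = -2 * Real.sin v * Real.sin u := by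
    rw [show a = v + u by rw [hu, hv]; ring, show b = v - u by rw [hu, hv]; ring,
      Real.cos_add, Real.cos_sub]
    ring
  -- `sin v ≥ sin u ≥ 0`
  have hsinu : 0 ≤ Real.sin u := Real.sin_nonneg_of_nonneg_of_le_pi hu0 (by linarith)
  have hsinv : Real.sin u ≤ Real.sin v := by
    rcases le_or_gt v (Real.pi / 2) with h1 | h1
    · exact Real.sin_le_sin_of_le_of_le_pi_div_two (by linarith) h1 (by rw [hu, hv]; linarith)
    · rw [← Real.sin_pi_sub v]
      exact Real.sin_le_sin_of_le_of_le_pi_div_two (by linarith) (by linarith) (by rw [hu, hv]; linarith)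
  have hjordan : 2 / Real.pi * u ≤ Real.sin u := Real.mul_le_sin hu0 huπ
  have h1 : 2 * Real.sin u ^ 2 ≤ t := by
    have h2 : |Real.cos a - Real.cos b| = 2 * Real.sin v * Real.sin u := by
      rw [hcos, show -2 * Real.sin v * Real.sin u = -(2 * Real.sin v * Real.sin u) by ring, abs_neg,
        abs_of_nonneg (by nlinarith)]
    nlinarith [h2, h]
  have h3 : 2 * (2 / Real.pi * u) ^ 2 ≤ t := by
    have := pow_le_pow_left₀ (by positivity) hjordan 2
    linarith
  have h4 : (a - b) ^ 2 ≤ (Real.pi * Real.sqrt (t / 2)) ^ 2 := by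
    rw [mul_pow, Real.sq_sqrt (by nlinarith [sq_nonneg (2 / Real.pi * u)])]
    have e1 : (2 / Real.pi * u) ^ 2 = (a - b) ^ 2 / Real.pi ^ 2 := by
      rw [hu]; field_simp
    rw [e1] at h3
    have h5 : (a - b) ^ 2 / Real.pi ^ 2 ≤ t / 2 := by linarith
    rw [div_le_iff₀ (by positivity)] at h5
    linarith
  exact le_of_pow_le_pow_left₀ two_ne_zero (by positivity) h4

variable {V : Type*} [NormedAddCommGroup V] [InnerProductSpace ℝ V]

/-- If `|‖u‖² − 1|, |‖v‖² − 1| ≤ ψ ≤ 1/2`, `|⟨u, v⟩ − C| ≤ Ψ` and `|C| ≤ 1`, then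
`|cos ∠(u, v) − C| ≤ 2Ψ + 2ψ`. [folklore] -/
theorem abs_cos_angle_sub_le {u v : V} {C Ψ ψ : ℝ} (hψ : ψ ≤ 1 / 2)
    (hu : |‖u‖ ^ 2 - 1| ≤ ψ) (hv : |‖v‖ ^ 2 - 1| ≤ ψ) (huv : |⟪u, v⟫ - C| ≤ Ψ) (hC : |C| ≤ 1) :
    |Real.cos (angle u v) - C| ≤ 2 * Ψ + 2 * ψ := by
  rw [cos_angle]
  set P : ℝ := ‖u‖ * ‖v‖ with hP
  have hP0 : 0 ≤ P := by positivity
  have hu2 := abs_le.1 hu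
  have hv2 := abs_le.1 hv
  have hPl : 1 - ψ ≤ P := by
    have h1 : (1 - ψ) ^ 2 ≤ P ^ 2 := by
      rw [hP, mul_pow]
      have h2 : 1 - ψ ≤ ‖u‖ ^ 2 := by linarith
      have h3 : 1 - ψ ≤ ‖v‖ ^ 2 := by linarith
      have h4 : 0 ≤ 1 - ψ := by linarith
      nlinarith [mul_le_mul h2 h3 h4 (sq_nonneg _)]
    exact le_of_pow_le_pow_left₀ two_ne_zero hP0 h1
  have hPu : P ≤ 1 + ψ := by
    have h1 : P ^ 2 ≤ (1 + ψ) ^ 2 := by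
      rw [hP, mul_pow]
      have h2 : ‖u‖ ^ 2 ≤ 1 + ψ := by linarith
      have h3 : ‖v‖ ^ 2 ≤ 1 + ψ := by linarith
      nlinarith [mul_le_mul h2 h3 (sq_nonneg _) (by linarith : (0:ℝ) ≤ 1 + ψ)]
    exact le_of_pow_le_pow_left₀ two_ne_zero (by linarith) h1
  have hPpos : 0 < P := by linarith
  have h1 : ⟪u, v⟫ / P - C = (⟪u, v⟫ - C + C * (1 - P)) / P := by field_simp; ring
  rw [h1, abs_div, abs_of_pos hPpos, div_le_iff₀ hPpos]
  refine (abs_add_le _ _).trans ?_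
  rw [abs_mul]
  have h2 : |1 - P| ≤ ψ := abs_le.2 ⟨by linarith, by linarith⟩
  have h3 : |C| * |1 - P| ≤ 1 * ψ := mul_le_mul hC h2 (abs_nonneg _) zero_le_one
  have hΨ : 0 ≤ Ψ := (abs_nonneg _).trans huv
  nlinarith

/-- For a unit vector `w` and `u` with `‖u − w‖ ≤ t`: `∠(u, w) ≤ π t` (normalise `u`, then
`‖u/‖u‖ − w‖ = 2 sin(∠/2) ≥ 2∠/π`). [folklore] -/
theorem angle_le_pi_mul_of_norm_sub_le {u w : V} {t : ℝ} (hw : ‖w‖ = 1) (h : ‖u - w‖ ≤ t) :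
    angle u w ≤ Real.pi * t := by
  have ht : 0 ≤ t := (norm_nonneg _).trans h
  by_cases hu : u = 0
  · -- `t ≥ 1`, and `∠ ≤ π`
    have h1 : 1 ≤ t := by rw [hu, zero_sub, norm_neg, hw] at h; exact h
    calc angle u w ≤ Real.pi := angle_le_pi _ _
      _ ≤ Real.pi * t := by nlinarith [Real.pi_pos]
  · have hupos : 0 < ‖u‖ := norm_pos_iff.2 hu
    set u' : V := ‖u‖⁻¹ • u with hu'
    have hu'1 : ‖u'‖ = 1 := by
      rw [hu', norm_smul, norm_inv, norm_norm, inv_mul_cancel₀ hupos.ne']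
    have hang : angle u w = angle u' w := by
      rw [hu', angle_smul_left_of_pos _ _ (inv_pos.2 hupos)]
    -- `‖u' − w‖ ≤ 2t`
    have hdist : ‖u' - w‖ ≤ 2 * t := by
      have h1 : ‖u' - u‖ = |1 - ‖u‖| := by
        have e1 : u' - u = (‖u‖⁻¹ - 1) • u := by rw [hu', sub_smul, one_smul]
        rw [e1, norm_smul, Real.norm_eq_abs]
        have e2 : |‖u‖⁻¹ - 1| * ‖u‖ = |1 - ‖u‖| := by
          rw [← abs_of_pos hupos, ← abs_mul, abs_of_pos hupos]
          congr 1
          field_simp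
        exact e2
      have h2 : |1 - ‖u‖| ≤ t := by
        have h3 := abs_norm_sub_norm_le u w
        rw [hw] at h3
        rw [abs_sub_comm]; exact h3.trans h
      calc ‖u' - w‖ ≤ ‖u' - u‖ + ‖u - w‖ := norm_sub_le_norm_sub_add_norm_sub _ _ _
        _ ≤ t + t := by rw [h1]; exact add_le_add h2 h
        _ = 2 * t := by ring
    -- `‖u' − w‖² = 2 − 2 cos ∠ = 4 sin²(∠/2)`
    set θ : ℝ := angle u' w with hθ
    have hθ0 : 0 ≤ θ := angle_nonneg _ _
    have hθπ : θ ≤ Real.pi := angle_le_pi _ _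
    have hsq : ‖u' - w‖ ^ 2 = 4 * Real.sin (θ / 2) ^ 2 := by
      rw [norm_sub_sq_real, hu'1, hw]
      have h1 : ⟪u', w⟫ = Real.cos θ := by
        rw [hθ, cos_angle, hu'1, hw, mul_one, div_one]
      rw [h1]
      have h2 : Real.cos θ = 1 - 2 * Real.sin (θ / 2) ^ 2 := by
        conv_lhs => rw [show θ = 2 * (θ / 2) by ring, Real.cos_two_mul, Real.cos_sq']
        ring
      rw [h2]; ring
    have hjordan : 2 / Real.pi * (θ / 2) ≤ Real.sin (θ / 2) :=
      Real.mul_le_sin (by linarith) (by linarith)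
    have h3 : (2 / Real.pi * (θ / 2)) ^ 2 ≤ Real.sin (θ / 2) ^ 2 :=
      pow_le_pow_left₀ (by positivity) hjordan 2
    have h4 : 4 * (2 / Real.pi * (θ / 2)) ^ 2 ≤ (2 * t) ^ 2 := by
      have h5 : ‖u' - w‖ ^ 2 ≤ (2 * t) ^ 2 := pow_le_pow_left₀ (norm_nonneg _) hdist 2
      linarith
    have h6 : θ ^ 2 ≤ (Real.pi * t) ^ 2 := by
      have e1 : 4 * (2 / Real.pi * (θ / 2)) ^ 2 = 4 * θ ^ 2 / Real.pi ^ 2 := by field_simp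
      rw [e1, div_le_iff₀ (by positivity)] at h4
      nlinarith [h4, Real.pi_pos]
    rw [hang]
    exact le_of_pow_le_pow_left₀ two_ne_zero (by positivity) h6

/-! ### Coordinates in `EuclideanSpace ℝ ι` -/

/-- `⟨toLp φ, toLp φ'⟩ = Σ_i φ_i φ'_i`. [folklore] -/
theorem inner_toLp_toLp {ι : Type*} [Fintype ι] (φ φ' : ι → ℝ) :
    ⟪(WithLp.toLp 2 φ : EuclideanSpace ℝ ι), WithLp.toLp 2 φ'⟫ = ∑ i, φ i * φ' i := by
  rw [PiLp.inner_apply]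
  refine Finset.sum_congr rfl fun i _ ↦ ?_
  rw [PiLp.toLp_apply, PiLp.toLp_apply, real_inner_comm, Real.inner_apply]
  ring

/-- `‖toLp φ‖² = Σ_i φ_i²`. [folklore] -/
theorem norm_toLp_sq {ι : Type*} [Fintype ι] (φ : ι → ℝ) :
    ‖(WithLp.toLp 2 φ : EuclideanSpace ℝ ι)‖ ^ 2 = ∑ i, φ i ^ 2 := by
  rw [EuclideanSpace.real_norm_sq_eq]

/-- `|φ_i − c_i| ≤ t` for all `i` gives `‖toLp φ − toLp c‖ ≤ √(card ι) t`. [folklore] -/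
theorem norm_toLp_sub_toLp_le {ι : Type*} [Fintype ι] {φ c : ι → ℝ} {t : ℝ} (ht : 0 ≤ t)
    (h : ∀ i, |φ i - c i| ≤ t) :
    ‖(WithLp.toLp 2 φ : EuclideanSpace ℝ ι) - WithLp.toLp 2 c‖ ≤ Real.sqrt (Fintype.card ι) * t := by
  have h1 : ‖(WithLp.toLp 2 φ : EuclideanSpace ℝ ι) - WithLp.toLp 2 c‖ ^ 2 ≤ (Real.sqrt (Fintype.card ι) * t) ^ 2 := by
    rw [← WithLp.toLp_sub, norm_toLp_sq, mul_pow, Real.sq_sqrt (Nat.cast_nonneg _)]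
    have h2 : ∀ i ∈ Finset.univ, (φ - c) i ^ 2 ≤ t ^ 2 := by
      intro i _
      rw [Pi.sub_apply, ← sq_abs]
      exact pow_le_pow_left₀ (abs_nonneg _) (h i) 2
    refine (Finset.sum_le_card_nsmul _ _ _ h2).trans ?_
    rw [Finset.card_univ, nsmul_eq_mul]
  exact le_of_pow_le_pow_left₀ two_ne_zero (by positivity) h1

end ColdingSynthetic

end Literature.Geometry.Riemannian

end
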